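import Summits.ValiantsHypothesis.ValiantsHypothesis.Theorems.EquivariantDialIdempotentSplitting
import HarnessLib

/-!
# Corner descent: a local corner carrying the determinant
(support of `CollapseToVPws`, stmt-ValiantsHypothesis-23702; road to `LocalShrinking`, part 2/3)

Honest scope.  This file is NOT a route and closes NO item.  VP ≠ VNP is NOT proved here and
nothing below is progress on it; 0 S-currency.  Cell A (`EqHardBiPerm`) is NOT proved in this
file; part 3/3 (`EquivariantDialLocalShrinking`) uses `exists_local_corner` below.

## Contents (Krull–Schmidt descent for an affine matrix with prime determinant)

Let `N` be a `d × d` matrix of affine forms with `det N = f`, `f` prime.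

* `corner_of_dvd` — if `C(U₀) N C(V₀) = X₁ ⊕ X₂` and `f ∣ det X₁`, then after rescaling one
  row `det X₁ = f`, `det X₂` is a nonzero constant and `X₁` is again affine.
* `descent_step` — if the intertwiner pair algebra of `N` is not local, `N` is equivalent
  (constant invertible left/right factors) to `X₁ ⊕ X₂` with `X₁` affine of size `q < d`,
  `det X₁ = f` and `det X₂` a nonzero constant (idempotent splitting, part 1/3, plus primality
  of `f`: it divides exactly one of the two block determinants up to units).
* `exists_local_corner` — iterating: `C(U) N C(V) = P ⊕ Q` with `P` affine, `det P = f`,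
  `IsLocalRepr P` (local intertwiner pair algebra) and `det Q` a nonzero constant.

Plus index bookkeeping for `Matrix.reindex` of block sums.  Classical mathematics; no Literature
fact is used as a hypothesis.

Labels (critic K5, CALL 2298).  Restricted-model lower bound, inside the equivariance barrier
(this part is the descent feeding it); 0 S-currency; closes NO item; `DcPerSuperpolynomial` /
VP ≠ VNP untouched.  Non-vacuity (K6): for the non-local affine pencil `N = diag(x, 1)`
(`2 × 2`, `det N = x` prime) `descent_step` / `exists_local_corner` produce the local corner
`P = (x)` of size `1 < 2` with `Q = (1)`; for a local `N` the corner is `N` itself (`r = d`).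
-/

set_option linter.dupNamespace false

namespace Summit.ValiantsHypothesis.ValiantsHypothesis.Theorems.EquivariantDialCornerDescent

noncomputable section

open MvPolynomial Matrix
open Literature.Computability.AlgebraicComplexity
open Summit.ValiantsHypothesis.ValiantsHypothesis.Theorems.EquivariantDialPairAlgebra
open Summit.ValiantsHypothesis.ValiantsHypothesis.Theorems.EquivariantDialIdempotentSplitting

section Reindex

variable {α : Type*}

/-- `reindex` is multiplicative (square case). -/
theorem reindex_mul_reindex {m n : Type*} [Fintype m] [Fintype n] [NonUnitalNonAssocSemiring α]
    (e : m ≃ n) (M N : Matrix m m α) :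
    Matrix.reindex e e M * Matrix.reindex e e N = Matrix.reindex e e (M * N) := by
  simp only [Matrix.reindex_apply, Matrix.submatrix_mul_equiv]

/-- `reindex` commutes with `map`. -/
theorem reindex_map {m n β : Type*} (e : m ≃ n) (M : Matrix m m α) (f : α → β) :
    (Matrix.reindex e e M).map f = Matrix.reindex e e (M.map f) := rfl

/-- `reindex` along a composite equivalence. -/
theorem reindex_trans_reindex {l m n : Type*} (a : l ≃ m) (b : m ≃ n) (M : Matrix l l α) :
    Matrix.reindex (a.trans b) (a.trans b) M = Matrix.reindex b b (Matrix.reindex a a M) := by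
  ext i j
  simp only [Matrix.reindex_apply, Matrix.submatrix_apply, Equiv.symm_trans_apply]

/-- Five-factor reassociation `A B N (D E) = A (B N D) E`. -/
theorem mul_five_assoc {n : Type*} [Fintype n] [NonUnitalSemiring α] (A B N D E : Matrix n n α) :
    A * B * N * (D * E) = A * (B * N * D) * E := by
  simp only [Matrix.mul_assoc]

variable [Zero α]

/-- Swapping the two blocks of a reindexed block sum. -/
theorem reindex_fromBlocks_swap {ι κ m : Type*} (e : ι ⊕ κ ≃ m) (X₁ : Matrix ι ι α)
    (X₂ : Matrix κ κ α) :
    Matrix.reindex e e (fromBlocks X₁ 0 0 X₂) =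
      Matrix.reindex ((Equiv.sumComm κ ι).trans e) ((Equiv.sumComm κ ι).trans e)
        (fromBlocks X₂ 0 0 X₁) := by
  ext i j
  obtain ⟨a, rfl⟩ := e.surjective i
  obtain ⟨b, rfl⟩ := e.surjective j
  rcases a with a | a <;> rcases b with b | b <;> simp [Matrix.reindex_apply]

/-- Reassociating an iterated block sum. -/
theorem fromBlocks_fromBlocks_eq_reindex {ι κ μ : Type*} (P : Matrix ι ι α) (Q : Matrix κ κ α)
    (X : Matrix μ μ α) :
    fromBlocks (fromBlocks P 0 0 Q) 0 0 X =
      Matrix.reindex (Equiv.sumAssoc ι κ μ).symm (Equiv.sumAssoc ι κ μ).symm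
        (fromBlocks P 0 0 (fromBlocks Q 0 0 X)) := by
  ext ((i | i) | i) ((j | j) | j) <;> simp [Matrix.reindex_apply]

/-- Reindexing the first block of a block sum. -/
theorem reindex_sumCongr_fromBlocks {ι ι' κ : Type*} (e₁ : ι ≃ ι') (A : Matrix ι ι α)
    (D : Matrix κ κ α) :
    Matrix.reindex (e₁.sumCongr (Equiv.refl κ)) (e₁.sumCongr (Equiv.refl κ)) (fromBlocks A 0 0 D) =
      fromBlocks (Matrix.reindex e₁ e₁ A) 0 0 D := by
  ext (i | i) (j | j) <;> simp [Matrix.reindex_apply]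

end Reindex

variable {k : Type*} [Field k] {σ : Type*}

/-- The upper-left block of a reindexed block decomposition inherits an entrywise degree bound. -/
theorem totalDegree_toBlock_le {m ι κ : Type*} {N' : Matrix m m (MvPolynomial σ k)} {n : ℕ}
    (hdeg : ∀ i j, (N' i j).totalDegree ≤ n) (e : ι ⊕ κ ≃ m)
    {X₁ : Matrix ι ι (MvPolynomial σ k)} {X₁₂ : Matrix ι κ (MvPolynomial σ k)}
    {X₂₁ : Matrix κ ι (MvPolynomial σ k)} {X₂ : Matrix κ κ (MvPolynomial σ k)}
    (h : N' = Matrix.reindex e e (fromBlocks X₁ X₁₂ X₂₁ X₂)) (i j : ι) :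
    (X₁ i j).totalDegree ≤ n := by
  have h' := hdeg (e (Sum.inl i)) (e (Sum.inl j))
  rw [h, Matrix.reindex_apply, Matrix.submatrix_apply, Equiv.symm_apply_apply,
    Equiv.symm_apply_apply, fromBlocks_apply₁₁] at h'
  exact h'

/-- Rescaling: if `det X = C c · f` with `c ≠ 0` (and `f` not a unit, which rules out the empty
matrix), a constant invertible left factor makes the determinant exactly `f`. -/
theorem exists_rescale_det {q : ℕ} {f : MvPolynomial σ k} (hf : ¬ IsUnit f)
    {X : Matrix (Fin q) (Fin q) (MvPolynomial σ k)} {c : k} (hc : c ≠ 0) (hX : X.det = C c * f) :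
    ∃ D : GL (Fin q) k, ((D : Matrix (Fin q) (Fin q) k).map C * X).det = f := by
  cases q with
  | zero =>
    exfalso
    refine hf (IsUnit.of_mul_eq_one_right (C c) ?_)
    rw [← hX, Matrix.det_isEmpty]
  | succ q =>
    obtain ⟨D₀, hD₀⟩ : ∃ D₀ : Matrix (Fin (q + 1)) (Fin (q + 1)) k,
        D₀ = Matrix.diagonal (fun i => if i = 0 then c⁻¹ else 1) := ⟨_, rfl⟩
    have hdetD₀ : D₀.det = c⁻¹ := by
      rw [hD₀, Matrix.det_diagonal, Finset.prod_ite_eq', if_pos (Finset.mem_univ _)]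
    have hD₀u : IsUnit D₀ := by
      rw [Matrix.isUnit_iff_isUnit_det, hdetD₀]
      exact IsUnit.mk0 _ (inv_ne_zero hc)
    refine ⟨hD₀u.unit, ?_⟩
    rw [IsUnit.unit_spec, Matrix.det_mul, det_map_C, hdetD₀, hX, ← mul_assoc, ← map_mul,
      inv_mul_cancel₀ hc, map_one, one_mul]

/-- **Carrying the determinant into a corner.** If `C(U₀) N C(V₀) = X₁ ⊕ X₂` with `N` affine,
`det N = f` prime and `f ∣ det X₁`, then after a constant rescaling of the first block:
`det X₁' = f`, `X₁'` affine, and `det X₂` is a nonzero constant. -/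
theorem corner_of_dvd {d q q' : ℕ} {f : MvPolynomial σ k} (hf : Prime f)
    {N : Matrix (Fin d) (Fin d) (MvPolynomial σ k)} (hdeg : ∀ i j, (N i j).totalDegree ≤ 1)
    (hdet : N.det = f) (e : Fin q ⊕ Fin q' ≃ Fin d) {U₀ V₀ : GL (Fin d) k}
    {X₁ : Matrix (Fin q) (Fin q) (MvPolynomial σ k)}
    {X₂ : Matrix (Fin q') (Fin q') (MvPolynomial σ k)}
    (hblock : (U₀ : Matrix (Fin d) (Fin d) k).map C * N * (V₀ : Matrix (Fin d) (Fin d) k).map C =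
      Matrix.reindex e e (fromBlocks X₁ 0 0 X₂))
    (hdvd : f ∣ X₁.det) :
    ∃ (U : GL (Fin d) k) (X₁' : Matrix (Fin q) (Fin q) (MvPolynomial σ k)) (c₂ : k),
      (U : Matrix (Fin d) (Fin d) k).map C * N * (V₀ : Matrix (Fin d) (Fin d) k).map C =
          Matrix.reindex e e (fromBlocks X₁' 0 0 X₂) ∧
        (∀ i j, (X₁' i j).totalDegree ≤ 1) ∧ X₁'.det = f ∧ c₂ ≠ 0 ∧ X₂.det = C c₂ := by
  set c₀ : k := (U₀ : Matrix (Fin d) (Fin d) k).det * (V₀ : Matrix (Fin d) (Fin d) k).det with hc₀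
  have hc₀0 : c₀ ≠ 0 :=
    mul_ne_zero (Matrix.isUnits_det_units U₀).ne_zero (Matrix.isUnits_det_units V₀).ne_zero
  have hdet' : X₁.det * X₂.det = C c₀ * f := by
    rw [← hdet, hc₀, ← det_map_C_mul_mul_map_C, hblock, Matrix.det_reindex_self,
      Matrix.det_fromBlocks_zero₂₁]
  obtain ⟨g, hg⟩ := hdvd
  have hgX₂ : g * X₂.det = C c₀ := by
    have h : f * (g * X₂.det) = f * C c₀ := by rw [← mul_assoc, ← hg, hdet', mul_comm]
    exact mul_left_cancel₀ hf.ne_zero h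
  have hunit : IsUnit (g * X₂.det) := by
    rw [hgX₂]
    exact (IsUnit.mk0 c₀ hc₀0).map C
  obtain ⟨c₁, hc₁, hgc₁⟩ := isUnit_iff_eq_C_of_isReduced.mp (isUnit_of_mul_isUnit_left hunit)
  obtain ⟨c₂, hc₂, hX₂c₂⟩ := isUnit_iff_eq_C_of_isReduced.mp (isUnit_of_mul_isUnit_right hunit)
  have hX₁det : X₁.det = C c₁ * f := by rw [hg, hgc₁, mul_comm]
  obtain ⟨D, hD⟩ := exists_rescale_det hf.not_unit hc₁.ne_zero hX₁det
  -- degrees of the entries of `X₁`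
  have hX₁deg : ∀ i j, (X₁ i j).totalDegree ≤ 1 :=
    totalDegree_toBlock_le (fun i j => totalDegree_map_C_mul_mul_map_C_le
      (U₀ : Matrix (Fin d) (Fin d) k) (V₀ : Matrix (Fin d) (Fin d) k) hdeg i j) e hblock
  -- extend `D` by the identity on the second block
  obtain ⟨W, hW⟩ : ∃ W : Matrix (Fin d) (Fin d) k,
      W = Matrix.reindex e e (fromBlocks (D : Matrix (Fin q) (Fin q) k) 0 0 1) := ⟨_, rfl⟩
  have hWu : IsUnit W := by
    rw [hW, Matrix.isUnit_iff_isUnit_det, Matrix.det_reindex_self, Matrix.det_fromBlocks_zero₂₁,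
      Matrix.det_one, mul_one]
    exact Matrix.isUnits_det_units D
  refine ⟨hWu.unit * U₀, (D : Matrix (Fin q) (Fin q) k).map C * X₁, c₂, ?_, ?_, hD, hc₂.ne_zero,
    hX₂c₂⟩
  · rw [Units.val_mul, IsUnit.unit_spec, Matrix.map_mul, Matrix.mul_assoc _ _ N, Matrix.mul_assoc,
      hblock, hW, reindex_map, reindex_mul_reindex, fromBlocks_map, fromBlocks_multiply]
    simp
  · intro i j
    have h := totalDegree_map_C_mul_mul_map_C_le (D : Matrix (Fin q) (Fin q) k)
      (1 : Matrix (Fin q) (Fin q) k) hX₁deg i j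
    rwa [Matrix.map_one C C_0 C_1, Matrix.mul_one] at h

/-- **Descent step.** A `d × d` affine matrix with prime determinant `f` whose intertwiner pair
algebra is not local is equivalent to a block sum `X₁ ⊕ X₂` with `X₁` affine of size `q < d`,
`det X₁ = f`, and `det X₂` a nonzero constant. -/
theorem descent_step [IsAlgClosed k] [CharZero k] {d : ℕ} {f : MvPolynomial σ k} (hf : Prime f)
    {N : Matrix (Fin d) (Fin d) (MvPolynomial σ k)} (hdeg : ∀ i j, (N i j).totalDegree ≤ 1)
    (hdet : N.det = f) (hnl : ¬ IsLocalRepr N) :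
    ∃ (q q' : ℕ) (e : Fin q ⊕ Fin q' ≃ Fin d) (U V : GL (Fin d) k)
      (X₁ : Matrix (Fin q) (Fin q) (MvPolynomial σ k))
      (X₂ : Matrix (Fin q') (Fin q') (MvPolynomial σ k)) (c₂ : k),
      q < d ∧
        (U : Matrix (Fin d) (Fin d) k).map C * N * (V : Matrix (Fin d) (Fin d) k).map C =
          Matrix.reindex e e (fromBlocks X₁ 0 0 X₂) ∧
        (∀ i j, (X₁ i j).totalDegree ≤ 1) ∧ X₁.det = f ∧ c₂ ≠ 0 ∧ X₂.det = C c₂ := by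
  have hN0 : N.det ≠ 0 := by
    rw [hdet]
    exact hf.ne_zero
  obtain ⟨e, he, hid, h0, h1⟩ := exists_idempotent_mem_pairAlg hnl
  obtain ⟨q, q', hq, U₀, V₀, X₁, X₂, hblock, hq0, hq'0⟩ :=
    exists_blockDiagonal_of_idempotent N he hid (trace_fst_eq_trace_snd hN0 he) h0 h1
  have hdvd : f ∣ X₁.det * X₂.det := by
    refine ⟨C ((U₀ : Matrix (Fin d) (Fin d) k).det * (V₀ : Matrix (Fin d) (Fin d) k).det), ?_⟩
    rw [← Matrix.det_fromBlocks_zero₂₁ X₁ 0 X₂,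
      ← Matrix.det_reindex_self (finSumFinEquiv.trans (finCongr hq)) (fromBlocks X₁ 0 0 X₂),
      ← hblock, det_map_C_mul_mul_map_C, hdet, mul_comm]
  rcases hf.dvd_or_dvd hdvd with h | h
  · obtain ⟨U, X₁', c₂, hblock', hdeg', hdet', hc₂, hX₂⟩ := corner_of_dvd hf hdeg hdet _ hblock h
    exact ⟨q, q', _, U, V₀, X₁', X₂, c₂, by omega, hblock', hdeg', hdet', hc₂, hX₂⟩
  · rw [reindex_fromBlocks_swap] at hblock
    obtain ⟨U, X₂', c₁, hblock', hdeg', hdet', hc₁, hX₁⟩ := corner_of_dvd hf hdeg hdet _ hblock h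
    exact ⟨q', q, _, U, V₀, X₂', X₁, c₁, by omega, hblock', hdeg', hdet', hc₁, hX₁⟩

/-- **Local corner.** Every `d × d` affine matrix `N` with prime determinant `f` is equivalent
(constant invertible left/right factors) to a block sum `P ⊕ Q` with `P` affine, `det P = f`,
`IsLocalRepr P`, and `det Q` a nonzero constant (over an algebraically closed field of
characteristic zero).  Induction on `d` via `descent_step`.  ★ Labels: restricted-model lower
bound, inside the equivariance barrier; 0 S-currency; closes NO item; `DcPerSuperpolynomial` /
VP ≠ VNP untouched. -/
theorem exists_local_corner [IsAlgClosed k] [CharZero k] {f : MvPolynomial σ k} (hf : Prime f)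
    (d : ℕ) :
    ∀ N : Matrix (Fin d) (Fin d) (MvPolynomial σ k), (∀ i j, (N i j).totalDegree ≤ 1) →
      N.det = f →
      ∃ (r : ℕ) (ι : Type) (_ : Fintype ι) (_ : DecidableEq ι) (e : Fin r ⊕ ι ≃ Fin d)
        (U V : GL (Fin d) k) (P : Matrix (Fin r) (Fin r) (MvPolynomial σ k))
        (Q : Matrix ι ι (MvPolynomial σ k)) (cQ : k),
        r ≤ d ∧
          (U : Matrix (Fin d) (Fin d) k).map C * N * (V : Matrix (Fin d) (Fin d) k).map C =
            Matrix.reindex e e (fromBlocks P 0 0 Q) ∧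
          (∀ i j, (P i j).totalDegree ≤ 1) ∧ P.det = f ∧ IsLocalRepr P ∧ cQ ≠ 0 ∧
          Q.det = C cQ := by
  induction d using Nat.strong_induction_on with
  | _ d ih =>
    intro N hdeg hdet
    by_cases hloc : IsLocalRepr N
    · refine ⟨d, Fin 0, inferInstance, inferInstance, Equiv.sumEmpty (Fin d) (Fin 0), 1, 1, N, 0, 1,
        le_rfl, ?_, hdeg, hdet, hloc, one_ne_zero, ?_⟩
      · rw [Units.val_one, Matrix.map_one C C_0 C_1, Matrix.one_mul, Matrix.mul_one]
        ext i j
        simp [Matrix.reindex_apply]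
      · rw [Matrix.det_isEmpty, C_1]
    · obtain ⟨q, q', ε, U₀, V₀, X₁, X₂, c₂, hqd, hblock, hdeg₁, hdet₁, hc₂, hdet₂⟩ :=
        descent_step hf hdeg hdet hloc
      obtain ⟨r, ι, _, _, e₁, U₁, V₁, P, Q₁, cQ₁, hrq, hblock₁, hdegP, hdetP, hlocP, hcQ₁,
          hdetQ₁⟩ :=
        ih q hqd X₁ hdeg₁ hdet₁
      -- extend `U₁, V₁` by the identity on the complementary block
      obtain ⟨WU, hWU⟩ : ∃ W : Matrix (Fin d) (Fin d) k,
          W = Matrix.reindex ε ε (fromBlocks (U₁ : Matrix (Fin q) (Fin q) k) 0 0 1) := ⟨_, rfl⟩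
      obtain ⟨WV, hWV⟩ : ∃ W : Matrix (Fin d) (Fin d) k,
          W = Matrix.reindex ε ε (fromBlocks (V₁ : Matrix (Fin q) (Fin q) k) 0 0 1) := ⟨_, rfl⟩
      have hWUu : IsUnit WU := by
        rw [hWU, Matrix.isUnit_iff_isUnit_det, Matrix.det_reindex_self,
          Matrix.det_fromBlocks_zero₂₁, Matrix.det_one, mul_one]
        exact Matrix.isUnits_det_units U₁
      have hWVu : IsUnit WV := by
        rw [hWV, Matrix.isUnit_iff_isUnit_det, Matrix.det_reindex_self,
          Matrix.det_fromBlocks_zero₂₁, Matrix.det_one, mul_one]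
        exact Matrix.isUnits_det_units V₁
      refine ⟨r, ι ⊕ Fin q', inferInstance, inferInstance,
        (Equiv.sumAssoc (Fin r) ι (Fin q')).symm.trans
          ((e₁.sumCongr (Equiv.refl (Fin q'))).trans ε),
        hWUu.unit * U₀, V₀ * hWVu.unit, P, fromBlocks Q₁ 0 0 X₂, cQ₁ * c₂, hrq.trans hqd.le, ?_,
        hdegP, hdetP, hlocP, mul_ne_zero hcQ₁ hc₂, ?_⟩
      · rw [Units.val_mul, Units.val_mul, IsUnit.unit_spec, IsUnit.unit_spec, Matrix.map_mul,
          Matrix.map_mul, mul_five_assoc, hblock, hWU, hWV, reindex_map, reindex_map,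
          reindex_mul_reindex, reindex_mul_reindex, fromBlocks_map, fromBlocks_map,
          fromBlocks_multiply, fromBlocks_multiply, reindex_trans_reindex, reindex_trans_reindex,
          ← fromBlocks_fromBlocks_eq_reindex, reindex_sumCongr_fromBlocks, ← hblock₁]
        simp
      · rw [Matrix.det_fromBlocks_zero₂₁, hdetQ₁, hdet₂, ← map_mul]

end

end Summit.ValiantsHypothesis.ValiantsHypothesis.Theorems.EquivariantDialCornerDescent
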